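import Literature.Topology.FourManifolds.KhBigon
import Literature.Topology.FourManifolds.GaussDiagramsRMoves
import HarnessLib

/-!
# The bigon of the anti-parallel second Reidemeister move (`Ω2c/Ω2d`) on a Gauss diagram

Sibling file of `KhBigon.lean` (the co-oriented bigon of `PolyakMove.omega2a`), opening the
invariance programme for the **anti-parallel** second Reidemeister move `RMove.omega2c` of
`GaussDiagramsRMoves.lean` (Polyak (2010), Fig. 2, `Ω2c, Ω2d`): two new chords `x` (index `n`,
sign `ε`) and `y` (index `n + 1`, sign `-ε`) whose over-passages are adjacent (`x` first) and
whose under-passages are adjacent in the *opposite* order (`y` first). By Polyak (2010), Thm. 1.2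
this move is not generated by the move set of `PolyakMove` (all first moves, `Ω2a/b`, `Ω3b`), so
the invariance of Khovanov homology and of Rasmussen\'s `s` under `GaussDiagram.REquiv` needs its
own bigon; on the other hand `{Ω1a, Ω1b, Ω2c, Ω2d, Ω3b}` generates all oriented Reidemeister moves
(Polyak (2010), Thm. 1.2), so this is the one missing local move. Up to a rotation of the base point
the pair of under-passages sits at the two last positions; this file fixes that normal form,

* `G.antiBigon m ε` — over-passages of `x, y` at `m, m + 1` (`m ≤ 2n`), under-passages of `y, x`
  at `2n + 2, 2n + 3`; it is an `RMove` away from `G` (`rMove_antiBigon`); the intermediate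
  diagram is the one of `KhBigon` (`G.bigonMid m true ε`), only the last insertion differs;

and records its bookkeeping exactly in the format of `KhBigon.lean` (primed names): passages,
chords, partners, signs, states (`antiState σ a b = Fin.snoc (Fin.snoc σ a) b`), Seifert rules and
Koszul signs of the two new chords, the six arcs around the new points — the two **sides of the
bigon** `sideM'` (from `m` to `m + 1`) and `sideE'` (from `2n + 2` to `2n + 3`) — and the gluing
clauses at the four new points, which are the ones that change: the chords now pair `m` with
`2n + 3` and `m + 1` with `2n + 2`. The planar picture is the bigon between two strands pointing in
OPPOSITE directions, and the difference with the co-oriented case is which corner of the square of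
`x, y` carries the small circle: for anti-parallel strands the *oriented* (Seifert) smoothing of
each new crossing is the one turning back along the other strand, so

* `inO_iff_of_adj'` — **the two sides of the bigon form a state circle by themselves in the
  resolution where BOTH new chords are smoothed à la Seifert** (the small circle `O` of
  Khovanov (2000), §5.3, Fig. 21 / Bar-Natan (2002), §4.3 sits at the oriented corner, and the
  corner isomorphic to `C(D)` is the one where neither new chord is Seifert — the opposite of
  `KhBigon`);
* `isSplitAt_stA'`, `isMergeAt_stO'` — **flipping the NEGATIVE new chord from the all-`0`
  resolution of `x, y` splits off `O`, and then flipping the positive one merges `O` back**, for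
  every Gauss diagram `G` and every state of the old chords (no planarity needed: the bigon is
  local). With `fC'` := the negative and `gC'` := the positive new chord, and `stO'`/`stD'` the
  oriented / unoriented corner, every statement below has literally the shape of its namesake in
  `KhBigon.lean`, so that the cancellation of `KhBigonD`, `KhBigonStates`, `KhBigonHomotopy`
  transfers.

No named fact is introduced.

## References

* M. Khovanov, *A categorification of the Jones polynomial*, Duke Math. J. 101 (2000) 359–426,
  §5.3 (invariance under the second move). [cite: Khovanov2000, §5.3]
* D. Bar-Natan, *On Khovanov\'s categorification of the Jones polynomial*, Algebr. Geom. Topol. 2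
  (2002) 337–370, §4.3. [cite: BarNatan2002, §4]
* M. Polyak, *Minimal generating sets of Reidemeister moves*, Quantum Topol. 1 (2010) 399–411,
  Thm. 1.2 and Fig. 2 (the moves `Ω2c, Ω2d` on Gauss diagrams). [cite: Polyak2010, Thm 1.2]
-/

open Function

noncomputable section

namespace Literature.Topology.FourManifolds

namespace GaussDiagram

variable (G : GaussDiagram) (m : Fin (2 * G.n + 1)) (ε : ℤˣ)

/-! ## The anti-parallel bigon -/

/-- Under-passage parameter of the second new chord `y`: the position `2n + 1` of the
intermediate diagram `G.bigonMid m true ε` (whose last point `2n + 1` is the under-passage of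
`x`), so that `y` passes under at `2n + 2` and pushes the under-passage of `x` to `2n + 3`.
[folklore] -/
def antiU₂ : Fin (2 * (G.bigonMid m true ε).n + 1) := ⟨2 * G.n + 1, by rw [bigonMid_n]; omega⟩

/-- The value of `antiU₂`. [folklore] -/
@[simp] theorem val_antiU₂ : (G.antiU₂ m ε : ℕ) = 2 * G.n + 1 := rfl

/-- **The bigon of the anti-parallel second Reidemeister move** in normal position: two new
chords `x` (index `n`, sign `ε`) and `y` (index `n + 1`, sign `-ε`); the over-passages of `x, y`
are at `m, m + 1` and the under-passages of `y, x` at `2n + 2, 2n + 3`. This is the target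
`(G.insertChord o u ε).insertChord o\' u\' (-ε)` of `RMove.omega2c` for these positions
(`rMove_antiBigon`); the first insertion is the one of `KhBigon` (`G.bigonMid m true ε`).
Polyak (2010), Fig. 2 (`Ω2c, Ω2d`); Khovanov (2000), §5.3. [cite: Polyak2010, Thm 1.2] -/
def antiBigon : GaussDiagram :=
  (G.bigonMid m true ε).insertChord (G.bigonO₂ m true ε) (G.antiU₂ m ε) (-ε)

/-- The anti-parallel bigon has two more chords. [folklore] -/
@[simp] theorem antiBigon_n : (G.antiBigon m ε).n = G.n + 2 := rfl

/-- The second embedding of old points: `p ↦ p` below `m + 1`, `p ↦ p + 1` from `m + 1` to `2n`,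
and the last point `2n + 1` (the under-passage of `x`) goes to `2n + 3`. [folklore] -/
theorem val_insEmb_antiBigon₂ (p : Fin (2 * (G.bigonMid m true ε).n)) :
    ((G.bigonMid m true ε).insEmb (G.bigonO₂ m true ε) (G.antiU₂ m ε) p : ℕ) =
      if p.val < m.val + 1 then p.val else if p.val < 2 * G.n + 1 then p.val + 1 else p.val + 2 := by
  rw [val_insEmb]
  have hp : p.val < 2 * G.n + 2 := by have := p.isLt; simp only [bigonMid_n] at this; omega
  have hm := m.isLt
  simp only [bigonO₂, antiU₂, ↓reduceIte, Fin.val_castSucc, bigonMid_n, val_bigonM']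
  split_ifs <;> omega

/-! ## Chords and passages of the antiBigon -/

/-- The index of an old chord in the antiBigon (written so as to match the lemmas of
`KhInsertChord` for both insertions). [folklore] -/
def oldC' (i : Fin G.n) : Fin (G.antiBigon m ε).n :=
  @Fin.castSucc (G.bigonMid m true ε).n (@Fin.castSucc G.n i)

/-- The index of the first new chord `x`. [folklore] -/
def bX' : Fin (G.antiBigon m ε).n := @Fin.castSucc (G.bigonMid m true ε).n (Fin.last G.n)

/-- The index of the second new chord `y`. [folklore] -/
def bY' : Fin (G.antiBigon m ε).n := Fin.last (G.bigonMid m true ε).n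

/-- The value of the index of an old chord. [folklore] -/
@[simp] theorem val_oldC' (i : Fin G.n) : (G.oldC' m ε i : ℕ) = i := rfl

/-- The value of the index of `x`. [folklore] -/
@[simp] theorem val_bX' : (G.bX' m ε : ℕ) = G.n := rfl

/-- The value of the index of `y`. [folklore] -/
@[simp] theorem val_bY' : (G.bY' m ε : ℕ) = G.n + 1 := rfl

/-- `oldC'` is injective. [folklore] -/
@[simp] theorem oldC_inj' {i j : Fin G.n} : G.oldC' m ε i = G.oldC' m ε j ↔ i = j := by
  constructor
  · intro h
    exact Fin.ext (by simpa using congrArg Fin.val h)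
  · rintro rfl
    rfl

/-- `x ≠ y`. [folklore] -/
theorem bX_ne_bY' : G.bX' m ε ≠ G.bY' m ε := fun h ↦ by
  have := congrArg Fin.val h; simp at this

/-- An old chord is not `x`. [folklore] -/
theorem oldC_ne_bX' (i : Fin G.n) : G.oldC' m ε i ≠ G.bX' m ε := fun h ↦ by
  have := congrArg Fin.val h; simp at this; omega

/-- An old chord is not `y`. [folklore] -/
theorem oldC_ne_bY' (i : Fin G.n) : G.oldC' m ε i ≠ G.bY' m ε := fun h ↦ by
  have := congrArg Fin.val h; simp at this; omega

/-- Every chord of the antiBigon is an old chord, `x` or `y`. [folklore] -/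
theorem eq_oldC_or_bX_or_bY' (j : Fin (G.antiBigon m ε).n) :
    (∃ i : Fin G.n, j = G.oldC' m ε i) ∨ j = G.bX' m ε ∨ j = G.bY' m ε := by
  rcases Fin.eq_castSucc_or_eq_last j with ⟨j', rfl⟩ | rfl
  · rcases Fin.eq_castSucc_or_eq_last j' with ⟨i, rfl⟩ | rfl
    · exact Or.inl ⟨i, rfl⟩
    · exact Or.inr (Or.inl rfl)
  · exact Or.inr (Or.inr rfl)

/-- The sign of `x` is `ε`. [folklore] -/
@[simp] theorem sign_antiBigon_bX : (G.antiBigon m ε).sign (G.bX' m ε) = ε :=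
  ((G.bigonMid m true ε).insertChord_sign_castSucc _ _ (-ε) (Fin.last G.n)).trans
    (G.insertChord_sign_last _ _ ε)

/-- The sign of `y` is `-ε`. [folklore] -/
@[simp] theorem sign_antiBigon_bY : (G.antiBigon m ε).sign (G.bY' m ε) = -ε :=
  (G.bigonMid m true ε).insertChord_sign_last _ _ (-ε)

/-- Old chords keep their signs. [folklore] -/
@[simp] theorem sign_antiBigon_oldC (i : Fin G.n) :
    (G.antiBigon m ε).sign (G.oldC' m ε i) = G.sign i :=
  ((G.bigonMid m true ε).insertChord_sign_castSucc _ _ (-ε) i.castSucc).trans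
    (G.insertChord_sign_castSucc _ _ ε i)

/-- The over-passage of `x` is `m`. [folklore] -/
theorem val_overPos_antiBigon_bX : ((G.antiBigon m ε).overPos (G.bX' m ε) : ℕ) = m.val := by
  have h1 : (G.antiBigon m ε).overPos (G.bX' m ε) = (G.bigonMid m true ε).insEmb (G.bigonO₂ m true ε)
      (G.antiU₂ m ε) ((G.bigonMid m true ε).overPos (Fin.last G.n)) :=
    (G.bigonMid m true ε).insertChord_overPos_castSucc_eq _ _ (-ε) (Fin.last G.n)
  have h2 : (G.bigonMid m true ε).overPos (Fin.last G.n) = G.bigonO₁ m true :=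
    G.insertChord_overPos_last _ _ ε
  rw [h1, val_insEmb_antiBigon₂, h2]
  have hm := m.isLt
  simp only [bigonO₁, ↓reduceIte, Fin.val_castSucc]
  split_ifs <;> omega

/-- The under-passage of `x` is `2n + 3` (the last point). [folklore] -/
theorem val_underPos_antiBigon_bX :
    ((G.antiBigon m ε).underPos (G.bX' m ε) : ℕ) = 2 * G.n + 3 := by
  have h1 : (G.antiBigon m ε).underPos (G.bX' m ε) = (G.bigonMid m true ε).insEmb (G.bigonO₂ m true ε)
      (G.antiU₂ m ε) ((G.bigonMid m true ε).underPos (Fin.last G.n)) :=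
    (G.bigonMid m true ε).insertChord_underPos_castSucc_eq _ _ (-ε) (Fin.last G.n)
  have h2 : (G.bigonMid m true ε).underPos (Fin.last G.n) =
      (G.bigonO₁ m true).succAbove (G.bigonU₁ m true) :=
    G.insertChord_underPos_last _ _ ε
  rw [h1, val_insEmb_antiBigon₂, h2, val_succAbove]
  have hm := m.isLt
  simp only [bigonO₁, bigonU₁, ↓reduceIte, Fin.val_last, Fin.val_castSucc]
  split_ifs <;> omega

/-- The over-passage of `y` is `m + 1`. [folklore] -/
theorem val_overPos_antiBigon_bY :
    ((G.antiBigon m ε).overPos (G.bY' m ε) : ℕ) = m.val + 1 := by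
  have h1 : (G.antiBigon m ε).overPos (G.bY' m ε) = G.bigonO₂ m true ε :=
    (G.bigonMid m true ε).insertChord_overPos_last _ _ (-ε)
  rw [h1]
  simp only [bigonO₂, ↓reduceIte, Fin.val_castSucc, val_bigonM']

/-- The under-passage of `y` is `2n + 2`. [folklore] -/
theorem val_underPos_antiBigon_bY :
    ((G.antiBigon m ε).underPos (G.bY' m ε) : ℕ) = 2 * G.n + 2 := by
  have h1 : (G.antiBigon m ε).underPos (G.bY' m ε) =
      (G.bigonO₂ m true ε).succAbove (G.antiU₂ m ε) :=
    (G.bigonMid m true ε).insertChord_underPos_last _ _ (-ε)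
  rw [h1, val_succAbove]
  have hm := m.isLt
  simp only [bigonO₂, antiU₂, ↓reduceIte, Fin.val_castSucc, bigonMid_n, val_bigonM']
  split_ifs <;> omega

/-- **The old passages are renumbered by `q ↦ q` below `m` and `q ↦ q + 2` from `m` on.**
[folklore] -/
theorem val_overPos_antiBigon_oldC (i : Fin G.n) :
    ((G.antiBigon m ε).overPos (G.oldC' m ε i) : ℕ) =
      if (G.overPos i).val < m.val then (G.overPos i).val else (G.overPos i).val + 2 := by
  have h1 : (G.antiBigon m ε).overPos (G.oldC' m ε i) = (G.bigonMid m true ε).insEmb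
      (G.bigonO₂ m true ε) (G.antiU₂ m ε) ((G.bigonMid m true ε).overPos i.castSucc) :=
    (G.bigonMid m true ε).insertChord_overPos_castSucc_eq _ _ (-ε) i.castSucc
  have h2 : (G.bigonMid m true ε).overPos i.castSucc =
      G.insEmb (G.bigonO₁ m true) (G.bigonU₁ m true) (G.overPos i) :=
    G.insertChord_overPos_castSucc_eq _ _ ε i
  rw [h1, val_insEmb_antiBigon₂, h2, val_insEmb_bigon₁]
  split_ifs <;> omega

/-- See `val_overPos_antiBigon_oldC`. [folklore] -/
theorem val_underPos_antiBigon_oldC (i : Fin G.n) :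
    ((G.antiBigon m ε).underPos (G.oldC' m ε i) : ℕ) =
      if (G.underPos i).val < m.val then (G.underPos i).val else (G.underPos i).val + 2 := by
  have h1 : (G.antiBigon m ε).underPos (G.oldC' m ε i) = (G.bigonMid m true ε).insEmb
      (G.bigonO₂ m true ε) (G.antiU₂ m ε) ((G.bigonMid m true ε).underPos i.castSucc) :=
    (G.bigonMid m true ε).insertChord_underPos_castSucc_eq _ _ (-ε) i.castSucc
  have h2 : (G.bigonMid m true ε).underPos i.castSucc =
      G.insEmb (G.bigonO₁ m true) (G.bigonU₁ m true) (G.underPos i) :=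
    G.insertChord_underPos_castSucc_eq _ _ ε i
  rw [h1, val_insEmb_antiBigon₂, h2, val_insEmb_bigon₁]
  split_ifs <;> omega

/-- **The anti-parallel bigon is a Reidemeister move away from `G`** (`RMove.omega2c`: the
over-passages of `x, y` are adjacent, `x` first, and the under-passages are adjacent, `y` first).
Polyak (2010), Fig. 2 (`Ω2c, Ω2d`). [cite: Polyak2010, Thm 1.2] -/
theorem rMove_antiBigon : RMove G (G.antiBigon m ε) := by
  refine RMove.omega2c G (G.bigonO₁ m true) (G.bigonU₁ m true) (G.bigonO₂ m true ε)
    (G.antiU₂ m ε) ε ?_ ?_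
  · show ((G.antiBigon m ε).overPos (G.bY' m ε) : ℕ) = (G.antiBigon m ε).overPos (G.bX' m ε) + 1
    rw [val_overPos_antiBigon_bY, val_overPos_antiBigon_bX]
  · show ((G.antiBigon m ε).underPos (G.bX' m ε) : ℕ) =
      (G.antiBigon m ε).underPos (G.bY' m ε) + 1
    rw [val_underPos_antiBigon_bY, val_underPos_antiBigon_bX]

/-- Hence the anti-parallel bigon is `REquiv`-equivalent to `G`. [cite: Polyak2010, Thm 1.2] -/
theorem rEquiv_antiBigon : G.REquiv (G.antiBigon m ε) := (G.rMove_antiBigon m ε).rEquiv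

/-! ## The four new marked points and the embedding of the old ones -/

/-- A marked point of the antiBigon from its number. [folklore] -/
def bPos' (k : ℕ) (hk : k < 2 * G.n + 4) : Fin (2 * (G.antiBigon m ε).n) :=
  ⟨k, by rw [antiBigon_n]; omega⟩

/-- The value of `bPos'`. [folklore] -/
@[simp] theorem val_bPos' (k : ℕ) (hk : k < 2 * G.n + 4) : (G.bPos' m ε k hk : ℕ) = k := rfl

/-- The new point `m` (over-passage of `x`). [folklore] -/
def posM' : Fin (2 * (G.antiBigon m ε).n) := G.bPos' m ε m.val (by omega)

/-- The new point `m + 1` (over-passage of `y`). [folklore] -/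
def posM1' : Fin (2 * (G.antiBigon m ε).n) := G.bPos' m ε (m.val + 1) (by omega)

/-- The new point `2n + 2` (under-passage of `y`). [folklore] -/
def posE' : Fin (2 * (G.antiBigon m ε).n) := G.bPos' m ε (2 * G.n + 2) (by omega)

/-- The new point `2n + 3` (under-passage of `x`). [folklore] -/
def posE1' : Fin (2 * (G.antiBigon m ε).n) := G.bPos' m ε (2 * G.n + 3) (by omega)

/-- **The embedding of the old marked points**: `q ↦ q` below `m`, `q ↦ q + 2` from `m` on.
[folklore] -/
def bEmb' (q : Fin (2 * G.n)) : Fin (2 * (G.antiBigon m ε).n) :=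
  G.bPos' m ε (if q.val < m.val then q.val else q.val + 2)
    (by have := q.isLt; split_ifs <;> omega)

/-- The value of `posM'`. [folklore] -/
@[simp] theorem val_posM' : (G.posM' m ε : ℕ) = m.val := rfl

/-- The value of `posM1'`. [folklore] -/
@[simp] theorem val_posM1' : (G.posM1' m ε : ℕ) = m.val + 1 := rfl

/-- The value of `posE'`. [folklore] -/
@[simp] theorem val_posE' : (G.posE' m ε : ℕ) = 2 * G.n + 2 := rfl

/-- The value of `posE1'`. [folklore] -/
@[simp] theorem val_posE1' : (G.posE1' m ε : ℕ) = 2 * G.n + 3 := rfl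

/-- The value of an embedded old point. [folklore] -/
@[simp] theorem val_bEmb' (q : Fin (2 * G.n)) :
    (G.bEmb' m ε q : ℕ) = if q.val < m.val then q.val else q.val + 2 := rfl

/-- The over-passage of `x` is `posM'`. [folklore] -/
theorem overPos_antiBigon_bX : (G.antiBigon m ε).overPos (G.bX' m ε) = G.posM' m ε :=
  Fin.ext (G.val_overPos_antiBigon_bX m ε)

/-- The under-passage of `x` is `posE1'`. [folklore] -/
theorem underPos_antiBigon_bX : (G.antiBigon m ε).underPos (G.bX' m ε) = G.posE1' m ε :=
  Fin.ext (G.val_underPos_antiBigon_bX m ε)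

/-- The over-passage of `y` is `posM1'`. [folklore] -/
theorem overPos_antiBigon_bY : (G.antiBigon m ε).overPos (G.bY' m ε) = G.posM1' m ε :=
  Fin.ext (G.val_overPos_antiBigon_bY m ε)

/-- The under-passage of `y` is `posE'`. [folklore] -/
theorem underPos_antiBigon_bY : (G.antiBigon m ε).underPos (G.bY' m ε) = G.posE' m ε :=
  Fin.ext (G.val_underPos_antiBigon_bY m ε)

/-- Old over-passages are embedded old points. [folklore] -/
@[simp] theorem overPos_antiBigon_oldC (i : Fin G.n) :
    (G.antiBigon m ε).overPos (G.oldC' m ε i) = G.bEmb' m ε (G.overPos i) :=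
  Fin.ext (G.val_overPos_antiBigon_oldC m ε i)

/-- Old under-passages are embedded old points. [folklore] -/
@[simp] theorem underPos_antiBigon_oldC (i : Fin G.n) :
    (G.antiBigon m ε).underPos (G.oldC' m ε i) = G.bEmb' m ε (G.underPos i) :=
  Fin.ext (G.val_underPos_antiBigon_oldC m ε i)

/-- The chord through `posM'` is `x`. [folklore] -/
@[simp] theorem chordOf_posM' : (G.antiBigon m ε).chordOf (G.posM' m ε) = G.bX' m ε := by
  have h := (G.antiBigon m ε).chordOf_overPos (G.bX' m ε)
  rwa [overPos_antiBigon_bX] at h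

/-- The chord through `posE1'` is `x`. [folklore] -/
@[simp] theorem chordOf_posE1' : (G.antiBigon m ε).chordOf (G.posE1' m ε) = G.bX' m ε := by
  have h := (G.antiBigon m ε).chordOf_underPos (G.bX' m ε)
  rwa [underPos_antiBigon_bX] at h

/-- The chord through `posM1'` is `y`. [folklore] -/
@[simp] theorem chordOf_posM1' : (G.antiBigon m ε).chordOf (G.posM1' m ε) = G.bY' m ε := by
  have h := (G.antiBigon m ε).chordOf_overPos (G.bY' m ε)
  rwa [overPos_antiBigon_bY] at h

/-- The chord through `posE'` is `y`. [folklore] -/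
@[simp] theorem chordOf_posE' : (G.antiBigon m ε).chordOf (G.posE' m ε) = G.bY' m ε := by
  have h := (G.antiBigon m ε).chordOf_underPos (G.bY' m ε)
  rwa [underPos_antiBigon_bY] at h

/-- The partner of `posM'` is `posE1'` (the chord `x` joins the first and the last new point).
[folklore] -/
@[simp] theorem partner_posM' : (G.antiBigon m ε).partner (G.posM' m ε) = G.posE1' m ε := by
  have h := (G.antiBigon m ε).partner_overPos (G.bX' m ε)
  rwa [underPos_antiBigon_bX, overPos_antiBigon_bX] at h

/-- The partner of `posE1'` is `posM'`. [folklore] -/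
@[simp] theorem partner_posE1' : (G.antiBigon m ε).partner (G.posE1' m ε) = G.posM' m ε := by
  rw [← partner_posM', partner_partner]

/-- The partner of `posM1'` is `posE'` (the chord `y` joins the two middle new points).
[folklore] -/
@[simp] theorem partner_posM1' : (G.antiBigon m ε).partner (G.posM1' m ε) = G.posE' m ε := by
  have h := (G.antiBigon m ε).partner_overPos (G.bY' m ε)
  rwa [underPos_antiBigon_bY, overPos_antiBigon_bY] at h

/-- The partner of `posE'` is `posM1'`. [folklore] -/
@[simp] theorem partner_posE' : (G.antiBigon m ε).partner (G.posE' m ε) = G.posM1' m ε := by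
  rw [← partner_posM1', partner_partner]

/-- The chord through an embedded old point is the old chord. [folklore] -/
@[simp] theorem chordOf_bEmb' (q : Fin (2 * G.n)) :
    (G.antiBigon m ε).chordOf (G.bEmb' m ε q) = G.oldC' m ε (G.chordOf q) := by
  obtain ⟨i, rfl | rfl⟩ := G.exists_chord q
  · rw [G.chordOf_overPos, ← overPos_antiBigon_oldC, chordOf_overPos]
  · rw [G.chordOf_underPos, ← underPos_antiBigon_oldC, chordOf_underPos]

/-- The partner of an embedded old point is the embedded old partner. [folklore] -/
@[simp] theorem partner_bEmb' (q : Fin (2 * G.n)) :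
    (G.antiBigon m ε).partner (G.bEmb' m ε q) = G.bEmb' m ε (G.partner q) := by
  obtain ⟨i, rfl | rfl⟩ := G.exists_chord q
  · rw [G.partner_overPos, ← overPos_antiBigon_oldC, partner_overPos, underPos_antiBigon_oldC]
  · rw [G.partner_underPos, ← underPos_antiBigon_oldC, partner_underPos, overPos_antiBigon_oldC]

/-- Every marked point of the antiBigon is an embedded old point or one of the four new points.
[folklore] -/
theorem eq_bEmb_or' (p : Fin (2 * (G.antiBigon m ε).n)) :
    (∃ q, p = G.bEmb' m ε q) ∨ p = G.posM' m ε ∨ p = G.posM1' m ε ∨ p = G.posE' m ε ∨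
      p = G.posE1' m ε := by
  have hp : p.val < 2 * G.n + 4 := by have := p.isLt; simp only [antiBigon_n] at this; omega
  have hm := m.isLt
  by_cases h1 : p.val < m.val
  · exact Or.inl ⟨⟨p.val, by omega⟩, Fin.ext (by simp [h1])⟩
  by_cases h2 : p.val = m.val
  · exact Or.inr (Or.inl (Fin.ext h2))
  by_cases h3 : p.val = m.val + 1
  · exact Or.inr (Or.inr (Or.inl (Fin.ext h3)))
  by_cases h4 : p.val < 2 * G.n + 2
  · refine Or.inl ⟨⟨p.val - 2, by omega⟩, Fin.ext ?_⟩
    simp only [val_bEmb']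
    rw [if_neg (by simp only [not_lt]; omega)]
    omega
  by_cases h5 : p.val = 2 * G.n + 2
  · exact Or.inr (Or.inr (Or.inr (Or.inl (Fin.ext h5))))
  · exact Or.inr (Or.inr (Or.inr (Or.inr (Fin.ext (by simp only [val_posE1']; omega)))))

/-! ## States of the antiBigon: `Fin.snoc (Fin.snoc σ a) b` -/

/-- The state of the antiBigon with old smoothings `σ` and smoothings `a`, `b` of `x`, `y`.
[folklore] -/
def antiState (σ : G.State) (a b : Bool) : (G.antiBigon m ε).State :=
  Fin.snoc (Fin.snoc σ a) b

/-- A state of the antiBigon at an old chord. [folklore] -/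
@[simp] theorem antiState_oldC (σ : G.State) (a b : Bool) (i : Fin G.n) :
    G.antiState m ε σ a b (G.oldC' m ε i) = σ i := by
  unfold antiState oldC'
  rw [Fin.snoc_castSucc, Fin.snoc_castSucc]

/-- A state of the antiBigon at `x`. [folklore] -/
@[simp] theorem antiState_bX (σ : G.State) (a b : Bool) :
    G.antiState m ε σ a b (G.bX' m ε) = a := by
  unfold antiState bX'
  rw [Fin.snoc_castSucc, Fin.snoc_last]

/-- A state of the antiBigon at `y`. [folklore] -/
@[simp] theorem antiState_bY (σ : G.State) (a b : Bool) :
    G.antiState m ε σ a b (G.bY' m ε) = b := by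
  unfold antiState bY'
  rw [Fin.snoc_last]

/-- Every state of the antiBigon is a `antiState`. [folklore] -/
theorem eq_antiState (τ : (G.antiBigon m ε).State) :
    τ = G.antiState m ε (fun i ↦ τ (G.oldC' m ε i)) (τ (G.bX' m ε)) (τ (G.bY' m ε)) := by
  funext j
  rcases G.eq_oldC_or_bX_or_bY' m ε j with ⟨i, rfl⟩ | rfl | rfl
  · rw [antiState_oldC]
  · rw [antiState_bX]
  · rw [antiState_bY]

/-- `antiState` is injective. [folklore] -/
theorem antiState_inj {σ σ' : G.State} {a a' b b' : Bool}
    (h : G.antiState m ε σ a b = G.antiState m ε σ' a' b') :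
    σ = σ' ∧ a = a' ∧ b = b' := by
  refine ⟨funext fun i ↦ ?_, ?_, ?_⟩
  · simpa using congrFun h (G.oldC' m ε i)
  · simpa using congrFun h (G.bX' m ε)
  · simpa using congrFun h (G.bY' m ε)

/-- Flipping an old chord. [folklore] -/
theorem update_antiState_oldC (σ : G.State) (a b : Bool) (i : Fin G.n) (c : Bool) :
    Function.update (G.antiState m ε σ a b) (G.oldC' m ε i) c =
      G.antiState m ε (Function.update σ i c) a b := by
  funext j
  rw [Function.update_apply]
  rcases G.eq_oldC_or_bX_or_bY' m ε j with ⟨i', rfl⟩ | rfl | rfl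
  · rw [antiState_oldC, antiState_oldC, Function.update_apply]
    simp only [oldC_inj']
  · rw [antiState_bX, antiState_bX, if_neg (G.oldC_ne_bX' m ε i).symm]
  · rw [antiState_bY, antiState_bY, if_neg (G.oldC_ne_bY' m ε i).symm]

/-- Flipping `x`. [folklore] -/
theorem update_antiState_bX (σ : G.State) (a b c : Bool) :
    Function.update (G.antiState m ε σ a b) (G.bX' m ε) c = G.antiState m ε σ c b := by
  funext j
  rw [Function.update_apply]
  rcases G.eq_oldC_or_bX_or_bY' m ε j with ⟨i', rfl⟩ | rfl | rfl
  · rw [antiState_oldC, antiState_oldC, if_neg (G.oldC_ne_bX' m ε i')]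
  · rw [antiState_bX, antiState_bX, if_pos rfl]
  · rw [antiState_bY, antiState_bY, if_neg (G.bX_ne_bY' m ε).symm]

/-- Flipping `y`. [folklore] -/
theorem update_antiState_bY (σ : G.State) (a b c : Bool) :
    Function.update (G.antiState m ε σ a b) (G.bY' m ε) c = G.antiState m ε σ a c := by
  funext j
  rw [Function.update_apply]
  rcases G.eq_oldC_or_bX_or_bY' m ε j with ⟨i', rfl⟩ | rfl | rfl
  · rw [antiState_oldC, antiState_oldC, if_neg (G.oldC_ne_bY' m ε i')]
  · rw [antiState_bX, antiState_bX, if_neg (G.bX_ne_bY' m ε)]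
  · rw [antiState_bY, antiState_bY, if_pos rfl]

/-- The Seifert rule at an old chord is the old one. [folklore] -/
@[simp] theorem isSeifert_antiBigon_oldC (σ : G.State) (a b : Bool) (i : Fin G.n) :
    (G.antiBigon m ε).isSeifert (G.antiState m ε σ a b) (G.oldC' m ε i) = G.isSeifert σ i := by
  simp [isSeifert]

/-- The Seifert rule at `x` (sign `ε`): the `0`-smoothing is Seifert's iff `ε = 1`. [folklore] -/
theorem isSeifert_antiBigon_bX (σ : G.State) (a b : Bool) :
    (G.antiBigon m ε).isSeifert (G.antiState m ε σ a b) (G.bX' m ε) =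
      ((a == false) == (ε == 1)) := by
  simp [isSeifert]

/-- The Seifert rule at `y` (sign `-ε`): the `0`-smoothing is Seifert's iff `ε = -1`. [folklore] -/
theorem isSeifert_antiBigon_bY (σ : G.State) (a b : Bool) :
    (G.antiBigon m ε).isSeifert (G.antiState m ε σ a b) (G.bY' m ε) =
      ((b == false) == (ε == -1)) := by
  have : (-ε == 1) = (ε == -1) := by
    rcases Int.units_eq_one_or ε with rfl | rfl <;> decide
  simp [isSeifert, this]

/-- The weight of a state of the antiBigon. [folklore] -/
theorem weight_antiState (σ : G.State) (a b : Bool) :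
    (G.antiState m ε σ a b).weight =
      σ.weight + (if a then 1 else 0) + (if b then 1 else 0) := by
  have h1 : (G.antiState m ε σ a b).weight =
      State.weight (G := G.bigonMid m true ε) (Fin.snoc σ a) + (if b then 1 else 0) :=
    (G.bigonMid m true ε).weight_snoc _ _ (-ε) (Fin.snoc σ a) b
  have h2 : State.weight (G := G.bigonMid m true ε) (Fin.snoc σ a) =
      σ.weight + (if a then 1 else 0) :=
    G.weight_snoc _ _ ε σ a
  rw [h1, h2]

/-- The antiBigon has one more positive crossing. [folklore] -/
theorem nPlus_antiBigon : (G.antiBigon m ε).nPlus = G.nPlus + 1 := by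
  have h1 : (G.antiBigon m ε).nPlus = (G.bigonMid m true ε).nPlus + if -ε = 1 then 1 else 0 :=
    (G.bigonMid m true ε).nPlus_insertChord _ _ (-ε)
  have h2 : (G.bigonMid m true ε).nPlus = G.nPlus + if ε = 1 then 1 else 0 :=
    G.nPlus_insertChord _ _ ε
  rw [h1, h2]
  rcases Int.units_eq_one_or ε with rfl | rfl <;> simp

/-- The antiBigon has one more negative crossing. [folklore] -/
theorem nMinus_antiBigon : (G.antiBigon m ε).nMinus = G.nMinus + 1 := by
  have h1 : (G.antiBigon m ε).nMinus = (G.bigonMid m true ε).nMinus + if -ε = -1 then 1 else 0 :=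
    (G.bigonMid m true ε).nMinus_insertChord _ _ (-ε)
  have h2 : (G.bigonMid m true ε).nMinus = G.nMinus + if ε = -1 then 1 else 0 :=
    G.nMinus_insertChord _ _ ε
  rw [h1, h2]
  rcases Int.units_eq_one_or ε with rfl | rfl <;> simp

/-- **Old chords keep their Koszul signs.** Khovanov (2000), §3.3. [cite: Khovanov2000, §3.3] -/
theorem edgeSign_antiState_oldC (σ : G.State) (a b : Bool) (i : Fin G.n) :
    edgeSign (G.antiState m ε σ a b) (G.oldC' m ε i) = edgeSign σ i := by
  have h1 : edgeSign (G.antiState m ε σ a b) (G.oldC' m ε i) =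
      edgeSign (G := G.bigonMid m true ε) (Fin.snoc σ a) i.castSucc :=
    (G.bigonMid m true ε).edgeSign_snoc_castSucc _ _ (-ε) (Fin.snoc σ a) b i.castSucc
  have h2 : edgeSign (G := G.bigonMid m true ε) (Fin.snoc σ a) i.castSucc = edgeSign σ i :=
    G.edgeSign_snoc_castSucc _ _ ε σ a i
  rw [h1, h2]

/-- **The Koszul sign of `x` is `(-1)^{|σ|}`.** Khovanov (2000), §3.3. [cite: Khovanov2000, §3.3] -/
theorem edgeSign_antiState_bX (σ : G.State) (a b : Bool) :
    edgeSign (G.antiState m ε σ a b) (G.bX' m ε) = (-1) ^ σ.weight := by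
  have h1 : edgeSign (G.antiState m ε σ a b) (G.bX' m ε) =
      edgeSign (G := G.bigonMid m true ε) (Fin.snoc σ a) (Fin.last G.n) :=
    (G.bigonMid m true ε).edgeSign_snoc_castSucc _ _ (-ε) (Fin.snoc σ a) b (Fin.last G.n)
  have h2 : edgeSign (G := G.bigonMid m true ε) (Fin.snoc σ a) (Fin.last G.n) = (-1) ^ σ.weight :=
    G.edgeSign_snoc_last _ _ ε σ a
  rw [h1, h2]

/-- **The Koszul sign of `y` is `(-1)^{|σ| + a}`.** Khovanov (2000), §3.3.
[cite: Khovanov2000, §3.3] -/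
theorem edgeSign_antiState_bY (σ : G.State) (a b : Bool) :
    edgeSign (G.antiState m ε σ a b) (G.bY' m ε) =
      (-1) ^ (σ.weight + if a then 1 else 0) := by
  have h1 : edgeSign (G.antiState m ε σ a b) (G.bY' m ε) =
      (-1) ^ State.weight (G := G.bigonMid m true ε) (Fin.snoc σ a) :=
    (G.bigonMid m true ε).edgeSign_snoc_last _ _ (-ε) (Fin.snoc σ a) b
  have h2 : State.weight (G := G.bigonMid m true ε) (Fin.snoc σ a) =
      σ.weight + (if a then 1 else 0) :=
    G.weight_snoc _ _ ε σ a
  rw [h1, h2]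

/-! ## Arcs around the new points -/

/-- The antiBigon has `2n + 4` arcs. [folklore] -/
theorem arcCount_antiBigon : (G.antiBigon m ε).arcCount = 2 * G.n + 4 := by
  show max (2 * (G.n + 2)) 1 = 2 * G.n + 4
  omega

/-- **The first side of the antiBigon**: the arc from `m` to `m + 1`. Khovanov (2000), §5.3.
[cite: Khovanov2000, §5.3] -/
def sideM' : (G.antiBigon m ε).Arc := (G.antiBigon m ε).arcOut (G.posM' m ε)

/-- **The second side of the antiBigon**: the arc from `2n + 2` to `2n + 3`. Khovanov (2000), §5.3.
[cite: Khovanov2000, §5.3] -/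
def sideE' : (G.antiBigon m ε).Arc := (G.antiBigon m ε).arcOut (G.posE' m ε)

/-- The arc entering `m`. [folklore] -/
def inM' : (G.antiBigon m ε).Arc := (G.antiBigon m ε).arcIn (G.posM' m ε)

/-- The arc leaving `m + 1`. [folklore] -/
def outM1' : (G.antiBigon m ε).Arc := (G.antiBigon m ε).arcOut (G.posM1' m ε)

/-- The arc entering `2n + 2` (number `2n + 1`). [folklore] -/
def inE' : (G.antiBigon m ε).Arc := (G.antiBigon m ε).arcIn (G.posE' m ε)

/-- The arc leaving `2n + 3` (number `2n + 3`, through the base point). [folklore] -/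
def outE1' : (G.antiBigon m ε).Arc := (G.antiBigon m ε).arcOut (G.posE1' m ε)

/-- The number of the first side. [folklore] -/
@[simp] theorem val_sideM' : (G.sideM' m ε : ℕ) = m.val := rfl
/-- The number of the second side. [folklore] -/
@[simp] theorem val_sideE' : (G.sideE' m ε : ℕ) = 2 * G.n + 2 := rfl
/-- The number of the arc leaving `m + 1`. [folklore] -/
@[simp] theorem val_outM1' : (G.outM1' m ε : ℕ) = m.val + 1 := rfl
/-- The number of the arc leaving `2n + 3`. [folklore] -/
@[simp] theorem val_outE1' : (G.outE1' m ε : ℕ) = 2 * G.n + 3 := rfl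

/-- The number of the arc entering `2n + 2`. [folklore] -/
@[simp] theorem val_inE' : (G.inE' m ε : ℕ) = 2 * G.n + 1 := by
  unfold inE'; rw [arcIn_val]; simp

/-- The number of the arc entering `m`: `m - 1`, or `2n + 3` if `m = 0`. [folklore] -/
theorem val_inM' : (G.inM' m ε : ℕ) = if m.val = 0 then 2 * G.n + 3 else m.val - 1 := by
  unfold inM'; rw [arcIn_val]; simp only [val_posM', antiBigon_n]; split_ifs <;> omega

/-- The arc entering `m + 1` is the first side. [folklore] -/
@[simp] theorem arcIn_posM1' : (G.antiBigon m ε).arcIn (G.posM1' m ε) = G.sideM' m ε := by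
  apply Fin.ext; rw [arcIn_val]; simp

/-- The arc entering `2n + 3` is the second side. [folklore] -/
@[simp] theorem arcIn_posE1' : (G.antiBigon m ε).arcIn (G.posE1' m ε) = G.sideE' m ε := by
  apply Fin.ext; rw [arcIn_val]; simp

/-- The number of the arc leaving an embedded old point. [folklore] -/
@[simp] theorem val_arcOut_bEmb' (q : Fin (2 * G.n)) :
    ((G.antiBigon m ε).arcOut (G.bEmb' m ε q) : ℕ) = if q.val < m.val then q.val else q.val + 2 :=
  rfl

/-- The number of the arc entering an embedded old point. [folklore] -/
theorem val_arcIn_bEmb' (q : Fin (2 * G.n)) :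
    ((G.antiBigon m ε).arcIn (G.bEmb' m ε q) : ℕ) =
      if q.val < m.val then (if q.val = 0 then 2 * G.n + 3 else q.val - 1) else q.val + 1 := by
  rw [arcIn_val, val_bEmb', antiBigon_n]
  have hq := q.isLt
  have hm := m.isLt
  by_cases h1 : q.val < m.val
  · rw [if_pos h1, if_pos h1]
    by_cases h2 : q.val = 0
    · rw [if_pos h2, if_pos h2]
      omega
    · rw [if_neg h2, if_neg h2]
  · rw [if_neg h1, if_neg h1, if_neg (show ¬ (q.val + 2 = 0) by omega)]
    omega

/-- **Membership in the small circle**: being one of the two sides of the antiBigon. [folklore] -/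
def InO' (a : (G.antiBigon m ε).Arc) : Prop := a = G.sideM' m ε ∨ a = G.sideE' m ε

/-- The first side is a side. [folklore] -/
theorem inO_sideM' : G.InO' m ε (G.sideM' m ε) := Or.inl rfl
/-- The second side is a side. [folklore] -/
theorem inO_sideE' : G.InO' m ε (G.sideE' m ε) := Or.inr rfl

/-- `InO'` read on numbers. [folklore] -/
theorem inO_iff' (a : (G.antiBigon m ε).Arc) :
    G.InO' m ε a ↔ a.val = m.val ∨ a.val = 2 * G.n + 2 := by
  unfold InO'
  rw [Fin.ext_iff, Fin.ext_iff]
  rfl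

/-- The arc entering `m` is not a side of the antiBigon. [folklore] -/
theorem not_inO_inM' : ¬ G.InO' m ε (G.inM' m ε) := by
  rw [inO_iff', val_inM']; have := m.isLt; split_ifs <;> omega

/-- The arc entering `2n + 2` is not a side of the antiBigon. [folklore] -/
theorem not_inO_inE' : ¬ G.InO' m ε (G.inE' m ε) := by
  rw [inO_iff', val_inE']; have := m.isLt; omega

/-- The arc leaving `m + 1` is not a side of the antiBigon. [folklore] -/
theorem not_inO_outM1' : ¬ G.InO' m ε (G.outM1' m ε) := by
  rw [inO_iff', val_outM1']; have := m.isLt; omega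

/-- The arc leaving `2n + 3` is not a side of the antiBigon. [folklore] -/
theorem not_inO_outE1' : ¬ G.InO' m ε (G.outE1' m ε) := by
  rw [inO_iff', val_outE1']; have := m.isLt; omega

/-- An arc leaving an old point is not a side of the antiBigon. [folklore] -/
theorem not_inO_arcOut_bEmb' (q : Fin (2 * G.n)) :
    ¬ G.InO' m ε ((G.antiBigon m ε).arcOut (G.bEmb' m ε q)) := by
  rw [inO_iff', val_arcOut_bEmb']; have := m.isLt; have := q.isLt; split_ifs <;> omega

/-- An arc entering an old point is not a side of the antiBigon. [folklore] -/
theorem not_inO_arcIn_bEmb' (q : Fin (2 * G.n)) :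
    ¬ G.InO' m ε ((G.antiBigon m ε).arcIn (G.bEmb' m ε q)) := by
  rw [inO_iff', val_arcIn_bEmb']; have := m.isLt; have := q.isLt; split_ifs <;> omega

/-- The two sides are distinct arcs. [folklore] -/
theorem sideM_ne_sideE' : G.sideM' m ε ≠ G.sideE' m ε := fun h ↦ by
  have := congrArg Fin.val h; simp at this; have := m.isLt; omega

/-- The two local strands at `x` (`arcIn (overPos x)`, `arcOut (overPos x)`): the first is off
the small circle, the second on it. [folklore] -/
theorem inO_strands_bX' :
    ¬ G.InO' m ε ((G.antiBigon m ε).arcIn ((G.antiBigon m ε).overPos (G.bX' m ε))) ∧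
      G.InO' m ε ((G.antiBigon m ε).arcOut ((G.antiBigon m ε).overPos (G.bX' m ε))) := by
  rw [overPos_antiBigon_bX]
  exact ⟨G.not_inO_inM' m ε, G.inO_sideM' m ε⟩

/-- The two local strands at `y`: the first is on the small circle, the second off it.
[folklore] -/
theorem inO_strands_bY' :
    G.InO' m ε ((G.antiBigon m ε).arcIn ((G.antiBigon m ε).overPos (G.bY' m ε))) ∧
      ¬ G.InO' m ε ((G.antiBigon m ε).arcOut ((G.antiBigon m ε).overPos (G.bY' m ε))) := by
  rw [overPos_antiBigon_bY, arcIn_posM1']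
  exact ⟨G.inO_sideM' m ε, G.not_inO_outM1' m ε⟩

/-! ## The gluing clauses at the four new points

Compared with `KhBigon.lean` the partners are exchanged (`m ↔ 2n + 3`, `m + 1 ↔ 2n + 2`), so the
Seifert gluings at the two ends of `x` are `inM' ~ outE1'` and `sideE' ~ sideM'`, those of `y` are
`sideM' ~ sideE'` and `inE' ~ outM1'`: **with both new chords Seifert the two sides of the bigon
close up into the small circle** and the outer strands turn back (`inM' ~ outE1'`,
`inE' ~ outM1'`), while with neither new chord Seifert the strands run through
(`inM' ~ sideE' ~ outM1'`, `inE' ~ sideM' ~ outE1'`), which is the picture of `G`. -/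

section Glue

variable (τ : (G.antiBigon m ε).State)

/-- The gluing clause at `m` (chord `x`, partner `2n + 3`). [folklore] -/
theorem glueRel_posM' (u v : (G.antiBigon m ε).Arc) :
    (G.antiBigon m ε).glueRel τ (G.posM' m ε) u v ↔
      ((G.antiBigon m ε).isSeifert τ (G.bX' m ε) = true ∧
          ((u = G.inM' m ε ∧ v = G.outE1' m ε) ∨ (v = G.inM' m ε ∧ u = G.outE1' m ε))) ∨
        ((G.antiBigon m ε).isSeifert τ (G.bX' m ε) = false ∧
          ((u = G.inM' m ε ∧ v = G.sideE' m ε) ∨ (u = G.sideM' m ε ∧ v = G.outE1' m ε))) := by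
  simp only [glueRel, chordOf_posM', partner_posM', arcIn_posE1']
  rfl

/-- The gluing clause at `2n + 3` (chord `x`, partner `m`). [folklore] -/
theorem glueRel_posE1' (u v : (G.antiBigon m ε).Arc) :
    (G.antiBigon m ε).glueRel τ (G.posE1' m ε) u v ↔
      ((G.antiBigon m ε).isSeifert τ (G.bX' m ε) = true ∧
          ((u = G.sideE' m ε ∧ v = G.sideM' m ε) ∨ (v = G.sideE' m ε ∧ u = G.sideM' m ε))) ∨
        ((G.antiBigon m ε).isSeifert τ (G.bX' m ε) = false ∧
          ((u = G.sideE' m ε ∧ v = G.inM' m ε) ∨ (u = G.outE1' m ε ∧ v = G.sideM' m ε))) := by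
  simp only [glueRel, chordOf_posE1', partner_posE1', arcIn_posE1']
  rfl

/-- The gluing clause at `m + 1` (chord `y`, partner `2n + 2`). [folklore] -/
theorem glueRel_posM1' (u v : (G.antiBigon m ε).Arc) :
    (G.antiBigon m ε).glueRel τ (G.posM1' m ε) u v ↔
      ((G.antiBigon m ε).isSeifert τ (G.bY' m ε) = true ∧
          ((u = G.sideM' m ε ∧ v = G.sideE' m ε) ∨ (v = G.sideM' m ε ∧ u = G.sideE' m ε))) ∨
        ((G.antiBigon m ε).isSeifert τ (G.bY' m ε) = false ∧
          ((u = G.sideM' m ε ∧ v = G.inE' m ε) ∨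
            (u = G.outM1' m ε ∧ v = G.sideE' m ε))) := by
  simp only [glueRel, chordOf_posM1', partner_posM1', arcIn_posM1']
  rfl

/-- The gluing clause at `2n + 2` (chord `y`, partner `m + 1`). [folklore] -/
theorem glueRel_posE' (u v : (G.antiBigon m ε).Arc) :
    (G.antiBigon m ε).glueRel τ (G.posE' m ε) u v ↔
      ((G.antiBigon m ε).isSeifert τ (G.bY' m ε) = true ∧
          ((u = G.inE' m ε ∧ v = G.outM1' m ε) ∨ (v = G.inE' m ε ∧ u = G.outM1' m ε))) ∨
        ((G.antiBigon m ε).isSeifert τ (G.bY' m ε) = false ∧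
          ((u = G.inE' m ε ∧ v = G.sideM' m ε) ∨
            (u = G.sideE' m ε ∧ v = G.outM1' m ε))) := by
  simp only [glueRel, chordOf_posE', partner_posE', arcIn_posM1']
  rfl

/-- A gluing at an old point does not involve the sides of the antiBigon. [folklore] -/
theorem not_inO_of_glueRel_bEmb' {q : Fin (2 * G.n)} {u v : (G.antiBigon m ε).Arc}
    (h : (G.antiBigon m ε).glueRel τ (G.bEmb' m ε q) u v) :
    ¬ G.InO' m ε u ∧ ¬ G.InO' m ε v := by
  unfold glueRel at h
  rw [partner_bEmb'] at h
  rcases h with ⟨-, ⟨rfl, rfl⟩ | ⟨rfl, rfl⟩⟩ | ⟨-, ⟨rfl, rfl⟩ | ⟨rfl, rfl⟩⟩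
  · exact ⟨G.not_inO_arcIn_bEmb' m ε _, G.not_inO_arcOut_bEmb' m ε _⟩
  · exact ⟨G.not_inO_arcOut_bEmb' m ε _, G.not_inO_arcIn_bEmb' m ε _⟩
  · exact ⟨G.not_inO_arcIn_bEmb' m ε _, G.not_inO_arcIn_bEmb' m ε _⟩
  · exact ⟨G.not_inO_arcOut_bEmb' m ε _, G.not_inO_arcOut_bEmb' m ε _⟩

variable {τ}
variable (hx : (G.antiBigon m ε).isSeifert τ (G.bX' m ε) = true)
  (hy : (G.antiBigon m ε).isSeifert τ (G.bY' m ε) = true)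

include hx hy in
/-- When BOTH new chords are smoothed à la Seifert, a gluing relates two arcs of the small
circle or two arcs off it. [folklore] -/
theorem inO_iff_of_glueRel' {p : Fin (2 * (G.antiBigon m ε).n)} {u v : (G.antiBigon m ε).Arc}
    (h : (G.antiBigon m ε).glueRel τ p u v) : G.InO' m ε u ↔ G.InO' m ε v := by
  rcases G.eq_bEmb_or' m ε p with ⟨q, rfl⟩ | rfl | rfl | rfl | rfl
  · obtain ⟨hu, hv⟩ := G.not_inO_of_glueRel_bEmb' m ε τ h
    exact ⟨fun h' ↦ (hu h').elim, fun h' ↦ (hv h').elim⟩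
  · rw [glueRel_posM', hx] at h
    rcases h with ⟨-, ⟨rfl, rfl⟩ | ⟨rfl, rfl⟩⟩ | ⟨h', -⟩
    · exact ⟨fun h' ↦ (G.not_inO_inM' m ε h').elim, fun h' ↦ (G.not_inO_outE1' m ε h').elim⟩
    · exact ⟨fun h' ↦ (G.not_inO_outE1' m ε h').elim, fun h' ↦ (G.not_inO_inM' m ε h').elim⟩
    · cases h'
  · rw [glueRel_posM1', hy] at h
    rcases h with ⟨-, ⟨rfl, rfl⟩ | ⟨rfl, rfl⟩⟩ | ⟨h', -⟩
    · exact ⟨fun _ ↦ G.inO_sideE' m ε, fun _ ↦ G.inO_sideM' m ε⟩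
    · exact ⟨fun _ ↦ G.inO_sideM' m ε, fun _ ↦ G.inO_sideE' m ε⟩
    · cases h'
  · rw [glueRel_posE', hy] at h
    rcases h with ⟨-, ⟨rfl, rfl⟩ | ⟨rfl, rfl⟩⟩ | ⟨h', -⟩
    · exact ⟨fun h' ↦ (G.not_inO_inE' m ε h').elim, fun h' ↦ (G.not_inO_outM1' m ε h').elim⟩
    · exact ⟨fun h' ↦ (G.not_inO_outM1' m ε h').elim, fun h' ↦ (G.not_inO_inE' m ε h').elim⟩
    · cases h'
  · rw [glueRel_posE1', hx] at h
    rcases h with ⟨-, ⟨rfl, rfl⟩ | ⟨rfl, rfl⟩⟩ | ⟨h', -⟩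
    · exact ⟨fun _ ↦ G.inO_sideM' m ε, fun _ ↦ G.inO_sideE' m ε⟩
    · exact ⟨fun _ ↦ G.inO_sideE' m ε, fun _ ↦ G.inO_sideM' m ε⟩
    · cases h'

include hx hy in
/-- **The small circle is a union of state circles** when both new chords are smoothed à la
Seifert: adjacency in the state graph preserves membership in `{sideM', sideE'}`.
Khovanov (2000), §5.3; Bar-Natan (2002), §4.3. [cite: Khovanov2000, §5.3] -/
theorem inO_iff_of_adj' {u v : (G.antiBigon m ε).Arc} (h : ((G.antiBigon m ε).stateGraph τ).Adj u v) :
    G.InO' m ε u ↔ G.InO' m ε v := by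
  rw [stateGraph_adj] at h
  obtain ⟨-, p, hp | hp⟩ := h
  · exact G.inO_iff_of_glueRel' m ε hx hy hp
  · exact (G.inO_iff_of_glueRel' m ε hx hy hp).symm

include hx hy in
/-- Reachability preserves membership in the small circle (both new chords Seifert). [folklore] -/
theorem inO_iff_of_reachable' {u v : (G.antiBigon m ε).Arc}
    (h : ((G.antiBigon m ε).stateGraph τ).Reachable u v) : G.InO' m ε u ↔ G.InO' m ε v := by
  obtain ⟨w⟩ := h
  induction w with
  | nil => rfl
  | cons hadj _ ih => exact (G.inO_iff_of_adj' m ε hx hy hadj).trans ih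

include hx in
/-- **The two sides of the antiBigon are glued to each other** when `x` is smoothed à la
Seifert (at the last point `2n + 3`). [folklore] -/
theorem adj_sideM_sideE' : ((G.antiBigon m ε).stateGraph τ).Adj (G.sideM' m ε) (G.sideE' m ε) := by
  rw [stateGraph_adj]
  exact ⟨G.sideM_ne_sideE' m ε, G.posE1' m ε,
    Or.inl ((G.glueRel_posE1' m ε τ _ _).2 (Or.inl ⟨hx, Or.inr ⟨rfl, rfl⟩⟩))⟩

include hx hy in
/-- **The small circle is exactly one state circle** (both new chords Seifert): an arc lies on
the circle of `sideM'` iff it is a side of the antiBigon. Khovanov (2000), §5.3. [cite: Khovanov2000, §5.3] -/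
theorem circleOf_eq_circleOf_sideM_iff' (u : (G.antiBigon m ε).Arc) :
    (G.antiBigon m ε).circleOf τ u = (G.antiBigon m ε).circleOf τ (G.sideM' m ε) ↔
      G.InO' m ε u := by
  rw [circleOf, circleOf, SimpleGraph.ConnectedComponent.eq]
  constructor
  · intro h
    exact (G.inO_iff_of_reachable' m ε hx hy h).2 (G.inO_sideM' m ε)
  · rintro (rfl | rfl)
    · rfl
    · exact (G.adj_sideM_sideE' m ε hx).reachable.symm

end Glue

/-! ## The four resolutions of the new chords

The bits are those of `KhBigon` (`oBitX ε = [ε = 1]`, `oBitY ε = [ε = -1]`), but the roles of the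
two mixed corners are exchanged: the small circle sits at the ORIENTED corner `stO'` (both new
chords Seifert: the negative one flipped), and the corner isomorphic to `C(D)` is `stD'` (neither
new chord Seifert: the positive one flipped). Accordingly the chord flipped first is the negative
one (`fC'`) and the chord flipped second is the positive one (`gC'`). -/

/-- **The all-`0` resolution** of the two new chords over the old state `σ` (the source corner
of the square of `x, y`). [folklore] -/
def stA' (σ : G.State) : (G.antiBigon m ε).State := G.antiState m ε σ false false

/-- **The resolution with the small circle**: the negative new chord flipped (both new chords
smoothed à la Seifert; for anti-parallel strands this is the corner `D' ⊔ O` of Khovanov (2000),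
§5.3, Fig. 21). [cite: Khovanov2000, §5.3] -/
def stO' (σ : G.State) : (G.antiBigon m ε).State :=
  G.antiState m ε σ (oBitY ε) (oBitX ε)

/-- **The all-`1` resolution** of the two new chords. [folklore] -/
def stU' (σ : G.State) : (G.antiBigon m ε).State := G.antiState m ε σ true true

/-- **The unoriented resolution** of the two new chords: the positive one flipped (neither new
chord smoothed à la Seifert; for anti-parallel strands this is the corner isomorphic to `C(D)`,
the two strands running through). Khovanov (2000), §5.3. [cite: Khovanov2000, §5.3] -/
def stD' (σ : G.State) : (G.antiBigon m ε).State :=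
  G.antiState m ε σ (oBitX ε) (oBitY ε)

/-- **The negative new chord** `f` (flipped first: `stA' → stO'`): `y` if `ε = 1`, `x` otherwise.
[folklore] -/
def fC' : Fin (G.antiBigon m ε).n := if ε = 1 then G.bY' m ε else G.bX' m ε

/-- **The positive new chord** `g` (flipped second: `stO' → stU'`): `x` if `ε = 1`, `y` otherwise.
[folklore] -/
def gC' : Fin (G.antiBigon m ε).n := if ε = 1 then G.bX' m ε else G.bY' m ε

variable (σ : G.State)

/-- `f` is `0`-smoothed in the all-`0` resolution. [folklore] -/
theorem stA_fC' : G.stA' m ε σ (G.fC' m ε) = false := by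
  unfold stA' fC'; split_ifs <;> simp

/-- `g` is `0`-smoothed in the all-`0` resolution. [folklore] -/
theorem stA_gC' : G.stA' m ε σ (G.gC' m ε) = false := by
  unfold stA' gC'; split_ifs <;> simp

/-- `g` is `0`-smoothed in the resolution with the small circle. [folklore] -/
theorem stO_gC' : G.stO' m ε σ (G.gC' m ε) = false := by
  unfold stO' gC' oBitX oBitY; split_ifs with h <;> simp [h]

/-- `f` is `1`-smoothed in the resolution with the small circle. [folklore] -/
theorem stO_fC' : G.stO' m ε σ (G.fC' m ε) = true := by
  unfold stO' fC' oBitX oBitY; split_ifs with h <;> simp [h]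

/-- Flipping `f` from the all-`0` resolution gives the resolution with the small circle. [folklore] -/
theorem update_stA_fC' : Function.update (G.stA' m ε σ) (G.fC' m ε) true = G.stO' m ε σ := by
  unfold stA' stO' fC' oBitX oBitY
  split_ifs with h
  · rw [update_antiState_bY]; simp [h]
  · rw [update_antiState_bX]; simp [h]

/-- Flipping `g` from the resolution with the small circle gives the all-`1` resolution. [folklore] -/
theorem update_stO_gC' : Function.update (G.stO' m ε σ) (G.gC' m ε) true = G.stU' m ε σ := by
  unfold stO' stU' gC' oBitX oBitY
  split_ifs with h
  · rw [update_antiState_bX]; simp [h]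
  · rw [update_antiState_bY]; simp [h]

/-- Flipping `g` from the all-`0` resolution gives the unoriented resolution. [folklore] -/
theorem update_stA_gC' : Function.update (G.stA' m ε σ) (G.gC' m ε) true = G.stD' m ε σ := by
  unfold stA' stD' gC' oBitX oBitY
  split_ifs with h
  · rw [update_antiState_bX]; simp [h]
  · rw [update_antiState_bY]; simp [h]

/-- Flipping `f` from the unoriented resolution gives the all-`1` resolution. [folklore] -/
theorem update_stD_fC' : Function.update (G.stD' m ε σ) (G.fC' m ε) true = G.stU' m ε σ := by
  unfold stD' stU' fC' oBitX oBitY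
  split_ifs with h
  · rw [update_antiState_bY]; simp [h]
  · rw [update_antiState_bX]; simp [h]

/-- In the resolution with the small circle, `x` is smoothed à la Seifert. [folklore] -/
theorem isSeifert_stO_bX' : (G.antiBigon m ε).isSeifert (G.stO' m ε σ) (G.bX' m ε) = true := by
  unfold stO' oBitY
  rw [isSeifert_antiBigon_bX]
  rcases Int.units_eq_one_or ε with rfl | rfl <;> decide

/-- In the resolution with the small circle, `y` is smoothed à la Seifert. [folklore] -/
theorem isSeifert_stO_bY' : (G.antiBigon m ε).isSeifert (G.stO' m ε σ) (G.bY' m ε) = true := by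
  unfold stO' oBitX
  rw [isSeifert_antiBigon_bY]
  rcases Int.units_eq_one_or ε with rfl | rfl <;> decide

/-- In the unoriented resolution, `x` is not smoothed à la Seifert. [folklore] -/
theorem isSeifert_stD_bX' : (G.antiBigon m ε).isSeifert (G.stD' m ε σ) (G.bX' m ε) = false := by
  unfold stD' oBitX
  rw [isSeifert_antiBigon_bX]
  rcases Int.units_eq_one_or ε with rfl | rfl <;> decide

/-- In the unoriented resolution, `y` is not smoothed à la Seifert. [folklore] -/
theorem isSeifert_stD_bY' : (G.antiBigon m ε).isSeifert (G.stD' m ε σ) (G.bY' m ε) = false := by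
  unfold stD' oBitY
  rw [isSeifert_antiBigon_bY]
  rcases Int.units_eq_one_or ε with rfl | rfl <;> decide

/-- **The strand of `f` on the small circle and the strand off it.** Exactly one of the two local
strands `arcIn (overPos f)`, `arcOut (overPos f)` is a side of the antiBigon. [folklore] -/
theorem inO_strands_fC' :
    (¬ G.InO' m ε ((G.antiBigon m ε).arcIn ((G.antiBigon m ε).overPos (G.fC' m ε))) ∧
        G.InO' m ε ((G.antiBigon m ε).arcOut ((G.antiBigon m ε).overPos (G.fC' m ε)))) ∨
      (G.InO' m ε ((G.antiBigon m ε).arcIn ((G.antiBigon m ε).overPos (G.fC' m ε))) ∧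
        ¬ G.InO' m ε ((G.antiBigon m ε).arcOut ((G.antiBigon m ε).overPos (G.fC' m ε)))) := by
  unfold fC'
  split_ifs
  · exact Or.inr (G.inO_strands_bY' m ε)
  · exact Or.inl (G.inO_strands_bX' m ε)

/-- Exactly one of the two local strands of `g` is a side of the antiBigon. [folklore] -/
theorem inO_strands_gC' :
    (¬ G.InO' m ε ((G.antiBigon m ε).arcIn ((G.antiBigon m ε).overPos (G.gC' m ε))) ∧
        G.InO' m ε ((G.antiBigon m ε).arcOut ((G.antiBigon m ε).overPos (G.gC' m ε)))) ∨
      (G.InO' m ε ((G.antiBigon m ε).arcIn ((G.antiBigon m ε).overPos (G.gC' m ε))) ∧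
        ¬ G.InO' m ε ((G.antiBigon m ε).arcOut ((G.antiBigon m ε).overPos (G.gC' m ε)))) := by
  unfold gC'
  split_ifs
  · exact Or.inl (G.inO_strands_bX' m ε)
  · exact Or.inr (G.inO_strands_bY' m ε)

/-- In the resolution with the small circle, the two local strands of a new chord lie on
different circles (one on the small circle, one off it). [folklore] -/
theorem circleOf_stO_strands_ne' {a b : (G.antiBigon m ε).Arc}
    (hab : (¬ G.InO' m ε a ∧ G.InO' m ε b) ∨ (G.InO' m ε a ∧ ¬ G.InO' m ε b)) :
    (G.antiBigon m ε).circleOf (G.stO' m ε σ) a ≠ (G.antiBigon m ε).circleOf (G.stO' m ε σ) b := by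
  intro h
  rw [circleOf, circleOf, SimpleGraph.ConnectedComponent.eq] at h
  have key := G.inO_iff_of_reachable' m ε (G.isSeifert_stO_bX' m ε σ)
    (G.isSeifert_stO_bY' m ε σ) h
  rcases hab with ⟨ha, hb⟩ | ⟨ha, hb⟩
  · exact ha (key.2 hb)
  · exact hb (key.1 ha)

/-- **Flipping the negative new chord from the all-`0` resolution is a split** (it splits off
the small circle), for every Gauss diagram and every old state. Khovanov (2000), §5.3;
Bar-Natan (2002), §4.3. [cite: Khovanov2000, §5.3] -/
theorem isSplitAt_stA' : (G.antiBigon m ε).IsSplitAt (G.stA' m ε σ) (G.fC' m ε) := by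
  refine ⟨G.stA_fC' m ε σ, ?_⟩
  rw [update_stA_fC']
  exact G.circleOf_stO_strands_ne' m ε σ (G.inO_strands_fC' m ε)

/-- **Flipping the positive new chord from the resolution with the small circle is a merge**
(it merges the small circle back), for every Gauss diagram and every old state.
Khovanov (2000), §5.3; Bar-Natan (2002), §4.3. [cite: Khovanov2000, §5.3] -/
theorem isMergeAt_stO' : (G.antiBigon m ε).IsMergeAt (G.stO' m ε σ) (G.gC' m ε) :=
  ⟨G.stO_gC' m ε σ, G.circleOf_stO_strands_ne' m ε σ (G.inO_strands_gC' m ε)⟩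

/-- In the resolution with the small circle, an arc lies on the circle of `sideM'` iff it is a
side of the antiBigon. [folklore] -/
theorem circleOf_stO_eq_iff' (u : (G.antiBigon m ε).Arc) :
    (G.antiBigon m ε).circleOf (G.stO' m ε σ) u =
        (G.antiBigon m ε).circleOf (G.stO' m ε σ) (G.sideM' m ε) ↔ G.InO' m ε u :=
  G.circleOf_eq_circleOf_sideM_iff' m ε (G.isSeifert_stO_bX' m ε σ)
    (G.isSeifert_stO_bY' m ε σ) u

end GaussDiagram

end Literature.Topology.FourManifolds
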